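import Literature.MathematicalPhysics.QuantumLattice.HubbardUVSymbolDressingFactorJetsGevrey
import Literature.MathematicalPhysics.QuantumLattice.HubbardSliceSymbolSmoothMomentum
import Literature.MathematicalPhysics.QuantumLattice.SalmhoferCutoffGevrey
import Literature.Analysis.Calculus.IteratedDerivCompGeometric
import HarnessLib

/-!
# Gevrey-2 jets of the SLICE symbol along a frame, with NUMERALS: `‖Dⁿ[Ψ̂_{(Λ,Λ′]}(ω, u(·))](p)‖ ≤ 16·|c|·(2/Λ)·(n!)²·(4E_u(1 + 10976/Λ))ⁿ`

Topic `MathematicalPhysics/QuantumLattice`.  The single-slice symbol `sliceSymbolFnXi c 0 Λ Λ′ ω ξ = W_{(Λ,Λ′]}(ω,ξ)·R(ξ)` (`HubbardSliceSymbolSmoothMomentum`;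
Salmhofer 1999 (4.70), BGM 2006 §2.3 (2.36aa)) is the DIFFERENCE of the two ultraviolet symbols `uvSymbolFnXi c Λ ω ξ − uvSymbolFnXi c Λ′ ω ξ`
(`sliceSymbolFnXi_zero_eq_uvSymbolFnXi_sub`), so its jets along any smooth band `u : E → ℝ` with single-factorial geometric jets `‖Dⁱu‖ ≤ i!·E_uⁱ`
inherit the Gevrey-2 envelope of `HubbardUVSymbolDressingFactorJetsGevrey.norm_iteratedFDeriv_uvSymbol_comp_le_gevrey` (there with a mismatch `v`; here `v = 0`),
and with the CERTIFIED Gevrey table of the cutoff (`SalmhoferCutoffGevrey`: `X₀ = 8`, `C_χ = 342`) every constant is a numeral: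

* `sliceSymbolFnXi_zero_eq_uvSymbolFnXi_sub` — `Ψ̂_{(Λ,Λ′]} = Ψ_Λ − Ψ_{Λ′}` at `θ = 0`;
* `norm_iteratedFDeriv_uvSymbol_comp_le_gevrey_band` — `‖Dⁿ[Ψ_Λ(ω,u(·))](p)‖ ≤ X₀|c|(2/Λ)·(n!)²·(4E_u(1+2·16(1+C_χ)/Λ))ⁿ` (the `v = 0` case);
* **`norm_iteratedFDeriv_sliceSymbolFnXi_comp_le_gevrey`** — the slice symbol along `u`: twice the `Λ`-bound (`0 < Λ ≤ Λ′`);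
* **`norm_iteratedFDeriv_sliceSymbolFnXi_comp_le_numeral`** — the same with `X₀ = 8`, `C_χ = 342`: `≤ 16|c|(2/Λ)(n!)²(4E_u(1 + 10976/Λ))ⁿ`;
* **`norm_iteratedFDeriv_sliceSymbolFnXi_comp_smul_le_numeral`** — composed with the rescaling `y ↦ a•y` (the unit-torus coordinate `a = 2π` of the aliasing
  tables): an extra factor `|a|ⁿ` (`Literature.Analysis.Calculus.norm_iteratedFDeriv_comp_smul_le`).

This is the shape of the «alias table» hypothesis `‖D^M(ŝ_{p₀} ∘ e_K ∘ 2π·)‖ ≤ D` of the aliasing-error bound for the sampled slice symbol (cell gate-hubbard-kl,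
C4a (A)-assembly input (iii)), now dischargeable from frame-level jets alone.  Everything is proved; no definitions; no named facts.

## Sources

M. Salmhofer, *Renormalization*, Springer 1999, §4.2.5 (4.70)–(4.71) [`Salmhofer1999`];
G. Benfatto, A. Giuliani, V. Mastropietro, Ann. Henri Poincaré 7 (2006) 809–898, §2.3 (2.36aa) [`BenfattoGiulianiMastropietro2006`].
-/

noncomputable section

namespace Literature.MathematicalPhysics.QuantumLattice

open Complex Finset Literature.Analysis.Calculus
open scoped Nat

variable {c Λ Λ' ω : ℝ}

/-- **The slice symbol is the difference of two ultraviolet symbols** (`θ = 0`): `Ψ̂_{(Λ,Λ′]}(ω,ξ) = Ψ_Λ(ω,ξ) − Ψ_{Λ′}(ω,ξ)`.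
[cite: Salmhofer1999, §4.2.5 (4.70)] -/
theorem sliceSymbolFnXi_zero_eq_uvSymbolFnXi_sub (c Λ Λ' ω ξ : ℝ) :
    sliceSymbolFnXi c 0 Λ Λ' ω ξ = uvSymbolFnXi c Λ ω ξ - uvSymbolFnXi c Λ' ω ξ := by
  simp only [sliceSymbolFnXi, sliceWeightFn, uvSymbolFnXi, uvWeightFn, add_comm (ξ ^ 2) (ω ^ 2)]
  push_cast
  ring

section Band

variable {E : Type} [NormedAddCommGroup E] [NormedSpace ℝ E]

/-- **The ultraviolet symbol along a band `u`** (no mismatch): `‖Dⁿ[Ψ_Λ(ω, u(·))](p)‖ ≤ X₀|c|(2/Λ)·(n!)²·(4E_u(1 + 2·16(1+C_χ)/Λ))ⁿ` for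
`‖Dⁱu(p)‖ ≤ i!·E_uⁱ` (`1 ≤ i ≤ n`), Gevrey table `‖χ₂^{(l)}‖ ≤ X₀(l!)²C_χ^l`. [cite: BenfattoGiulianiMastropietro2006, §2.3 (2.36aa)] -/
theorem norm_iteratedFDeriv_uvSymbol_comp_le_gevrey_band (hΛ : 0 < Λ) (hω : ω ≠ 0) {n : ℕ} {X₀ Cχ : ℝ} (hX1 : 1 ≤ X₀) (hC : 0 ≤ Cχ)
    (hX : ∀ l ≤ n, ∀ x : ℝ, ‖iteratedFDeriv ℝ l salmhoferCutoff x‖ ≤ X₀ * ((l ! : ℝ)) ^ 2 * Cχ ^ l) {u : E → ℝ} (hu : ContDiff ℝ (⊤ : ℕ∞) u)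
    {Eu : ℝ} (hEu : 0 ≤ Eu) (p : E) (hDu : ∀ i, 1 ≤ i → i ≤ n → ‖iteratedFDeriv ℝ i u p‖ ≤ i ! * Eu ^ i) :
    ‖iteratedFDeriv ℝ n (fun q : E => uvSymbolFnXi c Λ ω (u q)) p‖ ≤
      X₀ * (|c| * (2 / Λ)) * ((n ! : ℝ)) ^ 2 * (4 * Eu * (1 + 2 * (16 * (1 + Cχ) / Λ))) ^ n := by
  have hfun : (fun q : E => uvSymbolFnXi c Λ ω (u q)) = fun q : E => uvSymbolFnXi c Λ ω (u q + (fun _ : E => (0 : ℝ)) q) := by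
    funext q; simp
  rw [hfun]
  have h := norm_iteratedFDeriv_uvSymbol_comp_le_gevrey (c := c) (E := E) hΛ hω hX1 hC hX hu (contDiff_const (c := (0 : ℝ))) (Eu := Eu) (Fv := 0) (δ := 0)
    hEu le_rfl le_rfl p hDu (fun i _ => by
      have h0 : iteratedFDeriv ℝ i (fun _ : E => (0 : ℝ)) p = 0 := by
        rw [iteratedFDeriv_fun_zero]; rfl
      rw [h0, norm_zero]; positivity)
  refine h.trans (le_of_eq ?_)
  ring

/-- **GEVREY-2 JETS OF THE SLICE SYMBOL ALONG A BAND**: for `0 < Λ ≤ Λ′`, `ω ≠ 0`, `‖Dⁱu(p)‖ ≤ i!·E_uⁱ`,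
`‖Dⁿ[Ψ̂_{(Λ,Λ′]}(ω, u(·))](p)‖ ≤ 2·X₀|c|(2/Λ)·(n!)²·(4E_u(1 + 2·16(1+C_χ)/Λ))ⁿ` (both ultraviolet symbols obey the `Λ`-bound since `Λ ≤ Λ′`).
[cite: BenfattoGiulianiMastropietro2006, §2.3 (2.36aa)] -/
theorem norm_iteratedFDeriv_sliceSymbolFnXi_comp_le_gevrey (hΛ : 0 < Λ) (hΛΛ' : Λ ≤ Λ') (hω : ω ≠ 0) {n : ℕ} {X₀ Cχ : ℝ} (hX1 : 1 ≤ X₀) (hC : 0 ≤ Cχ)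
    (hX : ∀ l ≤ n, ∀ x : ℝ, ‖iteratedFDeriv ℝ l salmhoferCutoff x‖ ≤ X₀ * ((l ! : ℝ)) ^ 2 * Cχ ^ l) {u : E → ℝ} (hu : ContDiff ℝ (⊤ : ℕ∞) u)
    {Eu : ℝ} (hEu : 0 ≤ Eu) (p : E) (hDu : ∀ i, 1 ≤ i → i ≤ n → ‖iteratedFDeriv ℝ i u p‖ ≤ i ! * Eu ^ i) :
    ‖iteratedFDeriv ℝ n (fun q : E => sliceSymbolFnXi c 0 Λ Λ' ω (u q)) p‖ ≤
      2 * (X₀ * (|c| * (2 / Λ)) * ((n ! : ℝ)) ^ 2 * (4 * Eu * (1 + 2 * (16 * (1 + Cχ) / Λ))) ^ n) := by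
  have hΛ' : 0 < Λ' := hΛ.trans_le hΛΛ'
  have hX0 : 0 ≤ X₀ := zero_le_one.trans hX1
  have hN : ((n : ℕ∞) : WithTop ℕ∞) ≤ ((⊤ : ℕ∞) : WithTop ℕ∞) := by exact_mod_cast le_top
  have hfun : (fun q : E => sliceSymbolFnXi c 0 Λ Λ' ω (u q)) =
      (fun q : E => uvSymbolFnXi c Λ ω (u q)) - fun q : E => uvSymbolFnXi c Λ' ω (u q) := by
    funext q; simp [sliceSymbolFnXi_zero_eq_uvSymbolFnXi_sub]
  have h1 : ContDiff ℝ (⊤ : ℕ∞) (fun q : E => uvSymbolFnXi c Λ ω (u q)) := (contDiff_uvSymbolFnXi (c := c) (Λ := Λ) hω).comp hu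
  have h2 : ContDiff ℝ (⊤ : ℕ∞) (fun q : E => uvSymbolFnXi c Λ' ω (u q)) := (contDiff_uvSymbolFnXi (c := c) (Λ := Λ') hω).comp hu
  rw [hfun, iteratedFDeriv_sub_apply (h1.contDiffAt.of_le hN) (h2.contDiffAt.of_le hN)]
  refine (norm_sub_le _ _).trans ?_
  rw [two_mul]
  refine add_le_add (norm_iteratedFDeriv_uvSymbol_comp_le_gevrey_band hΛ hω hX1 hC hX hu hEu p hDu) ?_
  refine (norm_iteratedFDeriv_uvSymbol_comp_le_gevrey_band hΛ' hω hX1 hC hX hu hEu p hDu).trans ?_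
  -- the `Λ′`-bound is below the `Λ`-bound
  have hcΛ : |c| * (2 / Λ') ≤ |c| * (2 / Λ) := mul_le_mul_of_nonneg_left (div_le_div_of_nonneg_left (by norm_num) hΛ hΛΛ') (abs_nonneg c)
  have hρ : 4 * Eu * (1 + 2 * (16 * (1 + Cχ) / Λ')) ≤ 4 * Eu * (1 + 2 * (16 * (1 + Cχ) / Λ)) := by
    have : 16 * (1 + Cχ) / Λ' ≤ 16 * (1 + Cχ) / Λ := div_le_div_of_nonneg_left (by positivity) hΛ hΛΛ'
    nlinarith
  gcongr

/-- **Numeral form** (`X₀ = 8`, `C_χ = 342`, `SalmhoferCutoffGevrey.salmhoferCutoff_gevrey_table`):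
`‖Dⁿ[Ψ̂_{(Λ,Λ′]}(ω, u(·))](p)‖ ≤ 16·|c|·(2/Λ)·(n!)²·(4E_u(1 + 10976/Λ))ⁿ`. [cite: BenfattoGiulianiMastropietro2006, §2.3 (2.36aa)] -/
theorem norm_iteratedFDeriv_sliceSymbolFnXi_comp_le_numeral (hΛ : 0 < Λ) (hΛΛ' : Λ ≤ Λ') (hω : ω ≠ 0) {n : ℕ} {u : E → ℝ} (hu : ContDiff ℝ (⊤ : ℕ∞) u)
    {Eu : ℝ} (hEu : 0 ≤ Eu) (p : E) (hDu : ∀ i, 1 ≤ i → i ≤ n → ‖iteratedFDeriv ℝ i u p‖ ≤ i ! * Eu ^ i) :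
    ‖iteratedFDeriv ℝ n (fun q : E => sliceSymbolFnXi c 0 Λ Λ' ω (u q)) p‖ ≤
      16 * |c| * (2 / Λ) * ((n ! : ℝ)) ^ 2 * (4 * Eu * (1 + 10976 / Λ)) ^ n := by
  have h := norm_iteratedFDeriv_sliceSymbolFnXi_comp_le_gevrey (c := c) hΛ hΛΛ' hω (by norm_num : (1 : ℝ) ≤ 8) (by norm_num : (0 : ℝ) ≤ 342)
    (salmhoferCutoff_gevrey_table n) hu hEu p hDu
  refine h.trans (le_of_eq ?_)
  have : (2 : ℝ) * (16 * (1 + 342) / Λ) = 10976 / Λ := by ring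
  rw [this]
  ring

/-- **With the torus rescaling `y ↦ a•y`** (`a = 2π` for the unit-torus aliasing tables): if `‖Dⁱu(q)‖ ≤ i!·E_uⁱ` at EVERY point, then
`‖Dⁿ[y ↦ Ψ̂_{(Λ,Λ′]}(ω, u(a•y))](y)‖ ≤ |a|ⁿ·16|c|(2/Λ)(n!)²(4E_u(1 + 10976/Λ))ⁿ`. [cite: BenfattoGiulianiMastropietro2006, §2.3 (2.36aa)] -/
theorem norm_iteratedFDeriv_sliceSymbolFnXi_comp_smul_le_numeral (hΛ : 0 < Λ) (hΛΛ' : Λ ≤ Λ') (hω : ω ≠ 0) {n : ℕ} {u : E → ℝ}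
    (hu : ContDiff ℝ (⊤ : ℕ∞) u) {Eu : ℝ} (hEu : 0 ≤ Eu) (hDu : ∀ q : E, ∀ i, 1 ≤ i → i ≤ n → ‖iteratedFDeriv ℝ i u q‖ ≤ i ! * Eu ^ i)
    (a : ℝ) (y : E) :
    ‖iteratedFDeriv ℝ n (fun y : E => sliceSymbolFnXi c 0 Λ Λ' ω (u (a • y))) y‖ ≤
      |a| ^ n * (16 * |c| * (2 / Λ) * ((n ! : ℝ)) ^ 2 * (4 * Eu * (1 + 10976 / Λ)) ^ n) := by
  have hΛ' : 0 < Λ' := hΛ.trans_le hΛΛ'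
  have hg : ContDiff ℝ (⊤ : ℕ∞) (fun q : E => sliceSymbolFnXi c 0 Λ Λ' ω (u q)) := by
    have hfun : (fun q : E => sliceSymbolFnXi c 0 Λ Λ' ω (u q)) =
        (fun q : E => uvSymbolFnXi c Λ ω (u q)) - fun q : E => uvSymbolFnXi c Λ' ω (u q) := by
      funext q; simp [sliceSymbolFnXi_zero_eq_uvSymbolFnXi_sub]
    rw [hfun]
    exact ((contDiff_uvSymbolFnXi (c := c) (Λ := Λ) hω).comp hu).sub ((contDiff_uvSymbolFnXi (c := c) (Λ := Λ') hω).comp hu)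
  have hN : ((n : ℕ∞) : WithTop ℕ∞) ≤ ((⊤ : ℕ∞) : WithTop ℕ∞) := by exact_mod_cast le_top
  refine (norm_iteratedFDeriv_comp_smul_le (g := fun q : E => sliceSymbolFnXi c 0 Λ Λ' ω (u q)) hg a y hN).trans ?_
  exact mul_le_mul_of_nonneg_left (norm_iteratedFDeriv_sliceSymbolFnXi_comp_le_numeral hΛ hΛΛ' hω hu hEu (a • y) (hDu (a • y))) (by positivity)

end Band

end Literature.MathematicalPhysics.QuantumLattice

end
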